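import Summits.QuantumFields.BalabanUV.Beta.EriceRemainderEnclosureHistoryAutonomyComparisonAgeCompositionReadDecay

/-!
# EriceRemainderEnclosureHistoryAutonomyComparisonAgeCompositionEnteringLag — (E83a) MONO″ FOR A LONE WINDOW KERNEL IS DECIDED BY THE ENTERING LAG:
# with the ONE-LAG PERSISTENCE STRUCTURE of the flow's lone kernels (row `m+1`, aligned on targets, is `σ_m ×` row `m` except at the ENTERING lag
# `y−1`) the drops of a truncation solution satisfy the EXACT identity `σ_m·(d_m − d_{m+1}) = (1−σ_m)·d_{m+1} + σ_m·K_m(0)·t_{m+1} − e_m·t_{m+1+y}`;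
# hence they are non-increasing FOR FREE at every pin whose entering lag reads beyond the truncation edge, and at the other pins as soon as
# `(e_m − σ_mK_m(0)) ≤ Λ_{m+1}·(1 − σ_m − σ_mK_m(0))` (`Λ` the second Neumann term, a lower bound of the drop) — in the undamped flow `e_m = σ_mK_m(0)`
# and the criterion is EMPTY beyond the one-lag decay `σ_m(1 + K_m(0)) ≤ 1`

Cell `pub-balaban`, β-function sub-cell, BINDER row D4 «RemainderConst leaves for Bałaban's split» (`HOME/BINDER-OWNERS.md`; owner lineage `b2b-balaban-beta-an4`;
this file by co-owner #2 lineage `b2b-balaban-beta-d4-p2`, generation 74), β-FLOW TEAM duty (1), FREEZE (0) honoured (def-free; imports (E81a) `…ReadDecay` and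
uses (E71a) `read_nonneg`, `read_le_read`, `sol_eq_zero_of_tail`, `sol_nonneg_le_of_supersol`, (E81a) `drops_rec`, `drops_mem`, `input_sub_read_le_sol` BY NAME;
nothing restated).

HONEST FRAMING (page 1, verbatim and binding).  *"Discharging BetaPertH makes Bałaban's UV stability UNCONDITIONAL — a real constructive-QFT result; it is
NOT the continuum limit and NOT the Clay problem."*  THIS FILE DISCHARGES NOTHING OF THE KIND.  Elementary real algebra about ABSTRACT triangular renewal
systems — hypotheses of a census, not facts; the age profile of Bałaban's (1.22) limit functional is NOT PRINTED ([I] p. 298; GAPS G-t4-U2-1∕-2) and NOT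
asserted.  Row D4 class UNCHANGED (critical-path width 0; instance 0∕1; D4 DISCHARGE NO DATE).  HONEST DEPENDENCY: continuum YM on T⁴ ⇐ BetaPertH ∧ nine
spine estimates (0/9 proved); BetaPertH ⇐ (D1) ∧ (D4) ∧ CAP+tail; G-an2-4 gates asym, D1 and NE2/3/4.

THE POINT (census sense (α); route (N); `HOME/b2b-balaban-beta-d4-p2/g73/e82/README.md` §4 (1) asked for the SECOND-ORDER read-decay criterion `hold2` of
(E82d) along lone flows — numerically true with ratio ≈ 0.84 but an inequality in `2k+1` profile entries).  What (E82d)'s END actually consumes is MONO″ of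
the OLDEST age: the drops `d = R t` of the solution `t` of `t = 1_{[0,j]} − R t` are non-increasing in the pin.  For the flow's lone kernel of an age `y`
(`K_m(l) = c_m·Π_{t=m+1+l}^{m+y} g_t`, `l < y`) consecutive rows are PROPORTIONAL on the common targets: `K_{m+1}(l) = σ_m·K_m(l+1)` for `l + 1 < y`, with
`σ_m = (h_{m+y+1}∕h_{m+y})³·g_{m+y+1} = 1 − θ_y(m;1)` the one-lag persistence factor ((E75a)); only the ENTERING lag `e_m = K_{m+1}(y−1)` has no partner.
Hence (§1, `read_succ_onelag`) for EVERY sequence `t`: `R t (m+1) = σ_m·(R t m − K_m(0)·t(m+1)) + e_m·t(m+1+y)`, and for the truncation drops (§2):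
(A) `drops_step_edge`: if `j < m+1+y` the entering lag reads zero and `d_{m+1} = σ_m(d_m − K_m(0)t_{m+1}) ≤ d_m` — NO HYPOTHESIS; (B) `drops_step_of_crit`: if
`m+1+y ≤ j` then `t_{m+1} = 1 − d_{m+1}`, `t_{m+1+y} ≤ 1`, and `σ_m(d_m − d_{m+1}) ≥ d_{m+1}·(1 − σ_m − σ_mK_m(0)) − (e_m − σ_mK_m(0))`, so MONO″ at `m` follows
from **`e_m − σ_m·K_m(0) ≤ Λ_{m+1}·(1 − σ_m − σ_m·K_m(0))`** with `Λ = R v − R (R v) ≤ d` (the second Neumann term, (E81a) `input_sub_read_le_sol`) and the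
one-lag decay `σ_m(1 + K_m(0)) ≤ 1`.  `drops_antitone_onelag` assembles (A)+(B); `drops_antitone_onelag_full` uses the edge-free minorant `Λ^full_{m+1} =
Σ_l K_{m+1}(l)·(1 − x̃_{m+2+l})` (full row masses) so that ONE family of kernel inequalities, indexed by the pins `m` with `m+1+y ≤ N` only, serves every
truncation `j ≤ N`; §3 `mono2_top_of_onelag` says it in (E80f)'s letters `KL n`, `RL n`, `SL n` for the oldest age `n`.  WHY THIS IS THE RIGHT CUT
(numerics `HOME/b2b-balaban-beta-d4-p2/g74/numerics/o1.py`–`o5.py`): in the UNDAMPED class `e_m = σ_m·c_m = σ_m·K_m(0)` and the criterion's left side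
VANISHES — MONO″ of every lone age at every pin, horizon and truncation is then exactly the one-lag decay `c_{m+1}(1 + c_m) ≤ c_m` of the age's own
coefficient (margin ≈ 3λ − 1, `λ = h_{m+2y+1}∕h_{m+y} ≥ (2∕5)^{1∕2}`; proved along every box solution in (E83b)); with damping the left side is
`σ_m·c_m·(1 − Π_{t=m+1}^{m+y} g_t)` — the WINDOW DAMPING OF ROW `m` AGAINST THE UNDAMPED ENTERING ENTRY is the whole difficulty (relaxed class, lone flows:
criterion ratio ≤ 0.81 at the pin, → 1⁻ deep in the ultraviolet with margin ∝ (3λ − 2)·x; adversarial dampings = window at the floor, entering scale undamped).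
With the END's horizon `N = y + 1` ((E82e): `K = k + 1`) the only pin with `m+1+y ≤ N` is `m = 0`.  NOT CLAIMED: the criterion along damped flows;
anything nonlinear; anything printed.

WHAT IS PROVED ([folklore]; 0 `def`, 0 sorry).  §1 `read_eq_sum_window`, **`read_succ_onelag`**.  §2 `trunc_sol_support`, `trunc_sol_mem`, **`drops_step_edge`**,
**`drops_step_of_crit`**, **`drops_antitone_onelag`**, `second_term_ge_full`, **`drops_antitone_onelag_full`**.  §3 **`mono2_top_of_onelag`**.
-/
noncomputable section
open Finset

namespace Summit.QuantumFields.BalabanUV.Beta.EriceRemainderEnclosureHistoryAutonomyComparisonAgeCompositionEnteringLag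

open Summit.QuantumFields.BalabanUV.Beta.EriceRemainderEnclosureHistoryAutonomyComparisonAgeComposition
open Summit.QuantumFields.BalabanUV.Beta.EriceRemainderEnclosureHistoryAutonomyComparisonAgeCompositionReadDecay

variable {N y : ℕ} {K : ℕ → ℕ → ℝ} {R : (ℕ → ℝ) → ℕ → ℝ} {σ : ℕ → ℝ}

/-! ## §1 The one-lag identity for reads by a kernel with persistence structure -/

/-- A window kernel of length `y ≤ N` reads only the lags `< y`. [folklore] -/
theorem read_eq_sum_window (hR : ∀ v n, R v n = ∑ l ∈ range N, K n l * v (n + 1 + l)) (hKy : ∀ n l, y ≤ l → K n l = 0) (hyN : y ≤ N)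
    (t : ℕ → ℝ) (n : ℕ) : R t n = ∑ l ∈ range y, K n l * t (n + 1 + l) := by
  rw [hR, ← sum_range_add_sum_Ico _ hyN, add_eq_left]
  exact sum_eq_zero fun l hl => by rw [hKy n l (mem_Ico.mp hl).1, zero_mul]

/-- **THE ONE-LAG IDENTITY.**  Window kernel of length `1 ≤ y ≤ N` whose consecutive rows are proportional on the common targets — `K (m+1) l = σ m · K m (l+1)`
for `l + 1 < y` (the flow's one-lag persistence, an EQUALITY inside the window).  Then for every sequence `t` and pin `m`:
`R t (m+1) = σ m · (R t m − K m 0 · t (m+1)) + K (m+1) (y−1) · t (m+1+y)` — the leaving target `m+1` and the ENTERING lag `y−1` are the only unmatched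
terms. [folklore] -/
theorem read_succ_onelag (hR : ∀ v n, R v n = ∑ l ∈ range N, K n l * v (n + 1 + l)) (hKy : ∀ n l, y ≤ l → K n l = 0) (hy : 1 ≤ y) (hyN : y ≤ N)
    (hσ : ∀ n l, l + 1 < y → K (n + 1) l = σ n * K n (l + 1)) (t : ℕ → ℝ) (m : ℕ) :
    R t (m + 1) = σ m * (R t m - K m 0 * t (m + 1)) + K (m + 1) (y - 1) * t (m + 1 + y) := by
  obtain ⟨y', rfl⟩ : ∃ y', y = y' + 1 := ⟨y - 1, by omega⟩
  rw [read_eq_sum_window hR hKy hyN, read_eq_sum_window hR hKy hyN, sum_range_succ, sum_range_succ', Nat.add_sub_cancel,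
    show m + 1 + 1 + y' = m + 1 + (y' + 1) by ring, show m + 1 + 0 = m + 1 by ring, add_sub_cancel_right, mul_sum]
  congr 1
  exact sum_congr rfl fun l hl => by
    rw [hσ m l (by have := mem_range.mp hl; omega), show m + 1 + 1 + l = m + 1 + (l + 1) by ring]; ring

/-! ## §2 Drops of a truncation solution: free in the edge regime, a first-order criterion at the other pins -/

section Trunc

variable {j : ℕ} {t : ℕ → ℝ}

/-- The solution of `t = 1_{[0,j]} − R t` (zero tail, `j ≤ N`) vanishes beyond the edge `j`. [folklore] -/
theorem trunc_sol_support (hR : ∀ v n, R v n = ∑ l ∈ range N, K n l * v (n + 1 + l)) (hj : j ≤ N)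
    (htail : ∀ n, N < n → t n = 0) (hrec : ∀ n, t n = (if n ≤ j then (1:ℝ) else 0) - R t n) : ∀ n, j < n → t n = 0 :=
  fun n hn => sol_eq_zero_of_tail hR htail hrec (c := N - j) (fun n' hn' => if_neg (by omega)) n (by omega)

/-- Below the edge the solution is `1 −` its drop; everywhere it lies in `[0, 1]` once it lies in `[0, 1_{[0,j]}]`. [folklore] -/
theorem trunc_sol_mem (hrec : ∀ n, t n = (if n ≤ j then (1:ℝ) else 0) - R t n)
    (htv : ∀ n, 0 ≤ t n ∧ t n ≤ (if n ≤ j then (1:ℝ) else 0)) (n : ℕ) :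
    0 ≤ t n ∧ t n ≤ 1 ∧ (n ≤ j → t n = 1 - R t n) := by
  refine ⟨(htv n).1, (htv n).2.trans ?_, fun hn => by rw [hrec n, if_pos hn]⟩
  split_ifs <;> norm_num

/-- **(A) THE EDGE REGIME IS FREE.**  Non-negative window kernel with the one-lag structure, `0 ≤ σ ≤ 1`; `t ≥ 0` the truncation solution.  At every pin `m`
whose entering lag reads beyond the edge (`j < m+1+y`): `R t (m+1) = σ m · (R t m − K m 0 · t (m+1)) ≤ R t m`. [folklore] -/
theorem drops_step_edge (hR : ∀ v n, R v n = ∑ l ∈ range N, K n l * v (n + 1 + l)) (hK : ∀ n l, 0 ≤ K n l)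
    (hKy : ∀ n l, y ≤ l → K n l = 0) (hy : 1 ≤ y) (hyN : y ≤ N)
    (hσ : ∀ n l, l + 1 < y → K (n + 1) l = σ n * K n (l + 1)) (hσ01 : ∀ n, 0 ≤ σ n ∧ σ n ≤ 1) (hj : j ≤ N)
    (htail : ∀ n, N < n → t n = 0) (hrec : ∀ n, t n = (if n ≤ j then (1:ℝ) else 0) - R t n)
    (htv : ∀ n, 0 ≤ t n ∧ t n ≤ (if n ≤ j then (1:ℝ) else 0)) {m : ℕ} (hm : j < m + 1 + y) : R t (m + 1) ≤ R t m := by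
  have ht0 : ∀ n, 0 ≤ t n := fun n => (htv n).1
  rw [read_succ_onelag hR hKy hy hyN hσ t m, trunc_sol_support hR hj htail hrec _ hm, mul_zero, add_zero]
  have hd0 : 0 ≤ R t m := read_nonneg hR hK fun n _ => ht0 n
  nlinarith [hσ01 m, mul_nonneg (hK m 0) (ht0 (m + 1)), mul_nonneg (hσ01 m).1 (mul_nonneg (hK m 0) (ht0 (m + 1)))]

/-- **(B) THE CRITERION AT A PIN WHOSE ENTERING LAG READS INSIDE THE SUPPORT** (`m+1+y ≤ j`).  With `e = K (m+1) (y−1)`, `a = K m 0`, `σ = σ m > 0`: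
`σ(d_m − d_{m+1}) = (1−σ)d_{m+1} + σ·a·t_{m+1} − e·t_{m+1+y} ≥ d_{m+1}(1 − σ − σa) − (e − σa)` (`t_{m+1} = 1 − d_{m+1}`, `t_{m+1+y} ≤ 1`); so if the one-lag decay
`σ(1 + a) ≤ 1` holds and **`e − σ·a ≤ Λ·(1 − σ − σ·a)`** for some `Λ ≤ d_{m+1}`, then `d_{m+1} ≤ d_m`. [folklore] -/
theorem drops_step_of_crit (hR : ∀ v n, R v n = ∑ l ∈ range N, K n l * v (n + 1 + l))
    (hKy : ∀ n l, y ≤ l → K n l = 0) (hy : 1 ≤ y) (hyN : y ≤ N)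
    (hσ : ∀ n l, l + 1 < y → K (n + 1) l = σ n * K n (l + 1))
    (hrec : ∀ n, t n = (if n ≤ j then (1:ℝ) else 0) - R t n)
    (htv : ∀ n, 0 ≤ t n ∧ t n ≤ (if n ≤ j then (1:ℝ) else 0)) {m : ℕ} (hm : m + 1 + y ≤ j)
    (hσpos : 0 < σ m) (hbr : σ m * (1 + K m 0) ≤ 1) (he : 0 ≤ K (m + 1) (y - 1)) {Λ : ℝ} (hΛ : Λ ≤ R t (m + 1))
    (hcrit : K (m + 1) (y - 1) - σ m * K m 0 ≤ Λ * (1 - σ m - σ m * K m 0)) : R t (m + 1) ≤ R t m := by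
  have hid := read_succ_onelag hR hKy hy hyN hσ t m
  obtain ⟨_, hty1, -⟩ := trunc_sol_mem hrec htv (m + 1 + y)
  obtain ⟨-, -, ht1⟩ := trunc_sol_mem hrec htv (m + 1)
  have ht1 := ht1 (by omega)
  have hbr0 : 0 ≤ 1 - σ m - σ m * K m 0 := by linarith
  have h1 : Λ * (1 - σ m - σ m * K m 0) ≤ R t (m + 1) * (1 - σ m - σ m * K m 0) := mul_le_mul_of_nonneg_right hΛ hbr0
  have h2 : K (m + 1) (y - 1) * t (m + 1 + y) ≤ K (m + 1) (y - 1) := by nlinarith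
  -- σ (d_m − d_{m+1}) ≥ 0
  have key : 0 ≤ σ m * (R t m - R t (m + 1)) := by nlinarith
  nlinarith

/-- **MONO″ FOR A LONE WINDOW KERNEL FROM THE ENTERING-LAG CRITERION.**  Non-negative window kernel (`1 ≤ y ≤ N`) with the one-lag structure,
`0 < σ ≤ 1` with the one-lag decay `σ m·(1 + K m 0) ≤ 1`; `t` the zero-tailed solution of `t = 1_{[0,j]} − R t` (`j ≤ N`) lying in `[0, 1_{[0,j]}]`; and at
every pin `m` with `m+1+y ≤ j` the criterion `K (m+1) (y−1) − σ m·K m 0 ≤ (R v (m+1) − R (R v) (m+1))·(1 − σ m − σ m·K m 0)` (`v = 1_{[0,j]}`; the second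
Neumann term bounds the drop from below).  Then the drops `R t` are NON-INCREASING at every pin. [folklore] -/
theorem drops_antitone_onelag (hR : ∀ v n, R v n = ∑ l ∈ range N, K n l * v (n + 1 + l)) (hK : ∀ n l, 0 ≤ K n l)
    (hKy : ∀ n l, y ≤ l → K n l = 0) (hy : 1 ≤ y) (hyN : y ≤ N)
    (hσ : ∀ n l, l + 1 < y → K (n + 1) l = σ n * K n (l + 1)) (hσ01 : ∀ n, 0 < σ n ∧ σ n ≤ 1) (hbr : ∀ n, σ n * (1 + K n 0) ≤ 1)
    (hj : j ≤ N) (htail : ∀ n, N < n → t n = 0) (hrec : ∀ n, t n = (if n ≤ j then (1:ℝ) else 0) - R t n)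
    (htv : ∀ n, 0 ≤ t n ∧ t n ≤ (if n ≤ j then (1:ℝ) else 0))
    (hcrit : ∀ m, m + 1 + y ≤ j → K (m + 1) (y - 1) - σ m * K m 0 ≤
      (R (fun n => if n ≤ j then (1:ℝ) else 0) (m + 1) - R (R (fun n => if n ≤ j then (1:ℝ) else 0)) (m + 1)) * (1 - σ m - σ m * K m 0)) :
    ∀ m, R t (m + 1) ≤ R t m := by
  intro m
  rcases Nat.lt_or_ge j (m + 1 + y) with hm | hm
  · exact drops_step_edge hR hK hKy hy hyN hσ (fun n => ⟨(hσ01 n).1.le, (hσ01 n).2⟩) hj htail hrec htv hm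
  · -- the second Neumann term is below the drop: drops solve `d = R v − R d` and `d ≤ R v`
    have hdrec := drops_rec hR hrec
    have hU1 : ∀ n, R t n ≤ R (fun n => if n ≤ j then (1:ℝ) else 0) n := fun n => (drops_mem hR hK htv n).2
    have hΛ := input_sub_read_le_sol hR hK hdrec hU1 (m + 1)
    exact drops_step_of_crit hR hKy hy hyN hσ hrec htv hm (hσ01 m).1 (hbr m) (hK _ _) hΛ (hcrit m hm)

/-- Inside the support the second Neumann term dominates its edge-free minorant built from FULL row masses:
`Σ_{l<y} K (m+1) l · (1 − Σ_{l'} K (m+2+l) l') ≤ R v (m+1) − R (R v) (m+1)` when `m+1+y ≤ j`. [folklore] -/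
theorem second_term_ge_full (hR : ∀ v n, R v n = ∑ l ∈ range N, K n l * v (n + 1 + l)) (hK : ∀ n l, 0 ≤ K n l)
    (hKy : ∀ n l, y ≤ l → K n l = 0) (hyN : y ≤ N) {m : ℕ} (hm : m + 1 + y ≤ j) :
    ∑ l ∈ range y, K (m + 1) l * (1 - ∑ l' ∈ range N, K (m + 2 + l) l') ≤
      R (fun n => if n ≤ j then (1:ℝ) else 0) (m + 1) - R (R (fun n => if n ≤ j then (1:ℝ) else 0)) (m + 1) := by
  rw [← read_sub hR, read_eq_sum_window hR hKy hyN]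
  refine sum_le_sum fun l hl => ?_
  rw [show m + 1 + 1 + l = m + 2 + l by ring]
  refine mul_le_mul_of_nonneg_left ?_ (hK _ _)
  rw [if_pos (by have := mem_range.mp hl; omega), hR]
  exact sub_le_sub_left (sum_le_sum fun l' _ => by
    have := hK (m + 2 + l) l'
    split_ifs <;> nlinarith) _

/-- **MONO″ FOR EVERY TRUNCATION FROM ONE EDGE-FREE FAMILY OF KERNEL INEQUALITIES.**  As `drops_antitone_onelag`, with the criterion asked in the
`j`-independent form `K (m+1) (y−1) − σ m·K m 0 ≤ (Σ_{l<y} K (m+1) l·(1 − Σ_{l'} K (m+2+l) l'))·(1 − σ m − σ m·K m 0)` at the pins `m` with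
`m + 1 + y ≤ N` only (with the END's horizon `N = y + 1`: the single pin `m = 0`). [folklore] -/
theorem drops_antitone_onelag_full (hR : ∀ v n, R v n = ∑ l ∈ range N, K n l * v (n + 1 + l)) (hK : ∀ n l, 0 ≤ K n l)
    (hKy : ∀ n l, y ≤ l → K n l = 0) (hy : 1 ≤ y) (hyN : y ≤ N)
    (hσ : ∀ n l, l + 1 < y → K (n + 1) l = σ n * K n (l + 1)) (hσ01 : ∀ n, 0 < σ n ∧ σ n ≤ 1) (hbr : ∀ n, σ n * (1 + K n 0) ≤ 1)
    (hcrit : ∀ m, m + 1 + y ≤ N → K (m + 1) (y - 1) - σ m * K m 0 ≤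
      (∑ l ∈ range y, K (m + 1) l * (1 - ∑ l' ∈ range N, K (m + 2 + l) l')) * (1 - σ m - σ m * K m 0))
    (hj : j ≤ N) (htail : ∀ n, N < n → t n = 0) (hrec : ∀ n, t n = (if n ≤ j then (1:ℝ) else 0) - R t n)
    (htv : ∀ n, 0 ≤ t n ∧ t n ≤ (if n ≤ j then (1:ℝ) else 0)) : ∀ m, R t (m + 1) ≤ R t m := by
  refine drops_antitone_onelag hR hK hKy hy hyN hσ hσ01 hbr hj htail hrec htv fun m hm => (hcrit m (by omega)).trans ?_
  have hbr0 : 0 ≤ 1 - σ m - σ m * K m 0 := by linarith [hbr m]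
  exact mul_le_mul_of_nonneg_right (second_term_ge_full hR hK hKy hyN hm) hbr0

end Trunc

/-! ## §3 In the letters of (E80f) ∕ (E82d): MONO″ of the oldest age from the entering-lag criterion -/

section Ages

variable {KL : ℕ → ℕ → ℕ → ℝ} {RL SL : ℕ → (ℕ → ℝ) → ℕ → ℝ}

/-- **MONO″ OF THE OLDEST AGE FROM THE ENTERING-LAG CRITERION** — the shape of (E83c)'s hypothesis `hmono2top`.  Lone kernels `KL i ≥ 0` with reads `RL i`
and zero-tailed solution operators `SL i` on the horizon `N`; the age `n` has window length `1 ≤ y ≤ N` (`KL n m l = 0` for `l ≥ y`), the one-lag structure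
`KL n (m+1) l = σ m · KL n m (l+1)` (`l + 1 < y`) with `0 < σ ≤ 1` and the one-lag decay `σ m·(1 + KL n m 0) ≤ 1`, its truncation reads are supersolution
data (`RL n 1_{[0,j]} ≤ 1_{[0,j]}`, i.e. partial row masses `≤ 1` — KEY for the oldest age), and the entering-lag criterion holds at the pins `m` with
`m + 1 + y ≤ N`.  Then for every truncation `j ≤ N` the drops `m ↦ RL n (SL n 1_{[0,j]}) m` are NON-INCREASING. [folklore] -/
theorem mono2_top_of_onelag
    (hRL : ∀ i v m, RL i v m = ∑ l ∈ range N, KL i m l * v (m + 1 + l)) (hKL : ∀ i m l, 0 ≤ KL i m l)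
    (hSL : ∀ i (w : ℕ → ℝ), (∀ m, N < m → w m = 0) → (∀ m, N < m → SL i w m = 0) ∧ ∀ m, SL i w m = w m - RL i (SL i w) m)
    {n : ℕ} (hKLy : ∀ m l, y ≤ l → KL n m l = 0) (hy : 1 ≤ y) (hyN : y ≤ N)
    (hσ : ∀ m l, l + 1 < y → KL n (m + 1) l = σ m * KL n m (l + 1)) (hσ01 : ∀ m, 0 < σ m ∧ σ m ≤ 1) (hbr : ∀ m, σ m * (1 + KL n m 0) ≤ 1)
    (hkey : ∀ j, j ≤ N → ∀ m, RL n (fun m => if m ≤ j then (1:ℝ) else 0) m ≤ (fun m => if m ≤ j then (1:ℝ) else 0) m)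
    (hcrit : ∀ m, m + 1 + y ≤ N → KL n (m + 1) (y - 1) - σ m * KL n m 0 ≤
      (∑ l ∈ range y, KL n (m + 1) l * (1 - ∑ l' ∈ range N, KL n (m + 2 + l) l')) * (1 - σ m - σ m * KL n m 0)) :
    ∀ j, j ≤ N → ∀ m, RL n (SL n (fun m => if m ≤ j then (1:ℝ) else 0)) (m + 1) ≤ RL n (SL n (fun m => if m ≤ j then (1:ℝ) else 0)) m := by
  intro j hj
  have het : ∀ m, N < m → (fun m => if m ≤ j then (1:ℝ) else 0) m = 0 := fun m hm => if_neg (by omega)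
  have he0 : ∀ m, 0 ≤ (fun m => if m ≤ j then (1:ℝ) else 0) m := fun m => by beta_reduce; split_ifs <;> norm_num
  have htv := sol_nonneg_le_of_supersol (hRL n) (hKL n) he0 (hkey j hj) (hSL n _ het).1 (hSL n _ het).2
  exact drops_antitone_onelag_full (hRL n) (hKL n) hKLy hy hyN hσ hσ01 hbr hcrit hj (hSL n _ het).1 (hSL n _ het).2 htv

end Ages

end Summit.QuantumFields.BalabanUV.Beta.EriceRemainderEnclosureHistoryAutonomyComparisonAgeCompositionEnteringLag

end
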